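import Literature.Analysis.Complex.TypicallyReal
import Mathlib.Analysis.Complex.RemovableSingularity
import HarnessLib

/-!
# The expansion at `∞` of a hydrodynamically normalized map: `g(z) = z + a/(z - x₀) + O(a r/|z - x₀|²)`

G. F. Lawler, *Conformally Invariant Processes in the Plane*, AMS (2005), Prop. 3.46: "There is
a `c < ∞` such that for all `A ∈ 𝒬` and `|z| ≥ 2 rad(A)`,
`|z - g_A(z) + hcap(A)/z| ≤ c rad(A) hcap(A)/|z|²`", proved there with the Brownian-motion
representation of `Im[z - g_A(z)]`. Here is a function-theoretic proof with `c = 6`, for the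
abstract data that the Schwarz reflection of `g_A` across `ℝ ∖ [x₀ - r, x₀ + r]` provides
(`Literature.Analysis.Complex.IsHydrodynamicAt g x₀ r`): `g` holomorphic on `{|z - x₀| > r}`,
`g(z) - z → 0` at `∞`, `g(z̄) = \overline{g(z)}`, and `Im g ≤ Im` on the upper half of that
exterior. The inverted function `f(w) = g(x₀ + 1/w) - x₀ - 1/w` (removable singularity `f(0) = 0`)
is then typically real on `|w| < 1/r` (`TypicallyReal`), its derivative `a = f'(0)` at `0` is
REAL and NONNEGATIVE (`hcapAt g x₀`; it is `lim (z - x₀)(g(z) - z)`, the half-plane capacity,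
`tendsto_mul_sub_hcapAt`), and Rogosinski's growth bound gives

* `Literature.Analysis.Complex.IsHydrodynamicAt.norm_sub_sub_div_le` —
  **`|g(z) - z - a/(z - x₀)| ≤ 6 a r/|z - x₀|²` for `|z - x₀| ≥ 2r`** (when `a > 0`), and
* `Literature.Analysis.Complex.IsHydrodynamicAt.norm_sub_self_le` — `|g(z) - z| ≤ 4a/|z - x₀|`
  there.

## References

* G. F. Lawler, *Conformally Invariant Processes in the Plane* (2005), Prop. 3.46 [Lawler2005].
* W. Rogosinski, Math. Z. 35 (1932); P. L. Duren, *Univalent Functions* (1983), §2.8.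
-/

noncomputable section

open Set Filter Metric Bornology
open _root_.Complex _root_.Topology
open scoped ComplexConjugate

namespace Literature.Analysis.Complex

/-- **Hydrodynamically normalized symmetric map outside `B̄(x₀, r)`** — the data of the Schwarz
reflection of the map `g_A` of a half-plane hull `A ⊆ B̄(x₀, r)` (Lawler (2005), §3.4): `g` is
holomorphic on `{|z - x₀| > r}`, `g(z) - z → 0` at `∞`, `g` commutes with complex conjugation,
and `Im g(z) ≤ Im z` in the upper half of the exterior. [cite: Lawler2005, §3.4 (Prop. 3.36, Def. 3.37)] -/
structure IsHydrodynamicAt (g : ℂ → ℂ) (x₀ r : ℝ) : Prop where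
  pos : 0 < r
  differentiableOn : DifferentiableOn ℂ g {z : ℂ | r < ‖z - x₀‖}
  tendsto_sub : Tendsto (fun z ↦ g z - z) (cocompact ℂ) (𝓝 0)
  map_conj : ∀ z : ℂ, r < ‖z - x₀‖ → g (conj z) = conj (g z)
  im_le : ∀ z : ℂ, r < ‖z - x₀‖ → 0 < z.im → (g z).im ≤ z.im

/-- **The inverted function** `f(w) = g(x₀ + 1/w) - x₀ - 1/w`, `f(0) = 0`. [folklore] -/
def invertAt (g : ℂ → ℂ) (x₀ : ℝ) (w : ℂ) : ℂ :=
  if w = 0 then 0 else g (x₀ + w⁻¹) - x₀ - w⁻¹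

/-- **The half-plane capacity coefficient** `a = f'(0)` of `g` about `x₀` (the coefficient of
`1/(z - x₀)` in the expansion of `g` at `∞`; Lawler (2005), Def. 3.37 `hcap`).
[cite: Lawler2005, §3.4 Def. 3.37] -/
def hcapAt (g : ℂ → ℂ) (x₀ : ℝ) : ℝ := (deriv (invertAt g x₀) 0).re

namespace IsHydrodynamicAt

variable {g : ℂ → ℂ} {x₀ r : ℝ}

/-- `invertAt g x₀ 0 = 0`. [folklore] -/
@[simp] theorem invertAt_zero (g : ℂ → ℂ) (x₀ : ℝ) : invertAt g x₀ 0 = 0 := by simp [invertAt]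

/-- `f(w) = g(x₀ + 1/w) - x₀ - 1/w` for `w ≠ 0`. [folklore] -/
theorem invertAt_of_ne {w : ℂ} (hw : w ≠ 0) : invertAt g x₀ w = g (x₀ + w⁻¹) - x₀ - w⁻¹ := by
  simp [invertAt, hw]

/-- `f(1/(z - x₀)) = g(z) - z`. [folklore] -/
theorem invertAt_inv_sub {z : ℂ} (hz : z ≠ x₀) : invertAt g x₀ (z - x₀)⁻¹ = g z - z := by
  rw [invertAt_of_ne (inv_ne_zero (sub_ne_zero.2 hz)), inv_inv]; ring_nf

/-- For `0 < |w| < 1/r` the point `x₀ + 1/w` lies outside `B̄(x₀, r)`. [folklore] -/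
theorem lt_norm_of_mem_ball (h : IsHydrodynamicAt g x₀ r) {w : ℂ} (hw : w ∈ ball (0 : ℂ) r⁻¹)
    (hw0 : w ≠ 0) : r < ‖(x₀ : ℂ) + w⁻¹ - x₀‖ := by
  rw [add_sub_cancel_left, norm_inv]
  rw [mem_ball_zero_iff] at hw
  rwa [lt_inv_comm₀ h.pos (norm_pos_iff.2 hw0)]

/-- `f` is holomorphic on the punctured disc `0 < |w| < 1/r`. [folklore] -/
theorem differentiableOn_invertAt_punctured (h : IsHydrodynamicAt g x₀ r) :
    DifferentiableOn ℂ (invertAt g x₀) (ball 0 r⁻¹ \ {0}) := by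
  have heq : EqOn (invertAt g x₀) (fun w ↦ g (x₀ + w⁻¹) - x₀ - w⁻¹) (ball 0 r⁻¹ \ {0}) :=
    fun w hw ↦ invertAt_of_ne hw.2
  refine DifferentiableOn.congr ?_ heq
  have hinv : DifferentiableOn ℂ (fun w : ℂ ↦ (x₀ : ℂ) + w⁻¹) (ball 0 r⁻¹ \ {0}) :=
    (differentiableOn_const _).add (differentiableOn_inv.mono fun w hw ↦ hw.2)
  refine ((h.differentiableOn.comp hinv fun w hw ↦ h.lt_norm_of_mem_ball hw.1 hw.2).sub_const _).sub
    (differentiableOn_inv.mono fun w hw ↦ hw.2)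

/-- `f(w) → 0 = f(0)` as `w → 0` (`g(z) - z → 0` at `∞`). [folklore] -/
theorem continuousAt_invertAt (h : IsHydrodynamicAt g x₀ r) : ContinuousAt (invertAt g x₀) 0 := by
  rw [ContinuousAt, invertAt_zero]
  have h1 : Tendsto (fun w : ℂ ↦ (x₀ : ℂ) + w⁻¹) (𝓝[≠] 0) (cocompact ℂ) := by
    rw [← cobounded_eq_cocompact, ← tendsto_norm_atTop_iff_cobounded]
    have h0 : Tendsto (fun w : ℂ ↦ ‖w⁻¹‖ + -‖(x₀ : ℂ)‖) (𝓝[≠] 0) atTop :=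
      tendsto_atTop_add_const_right _ _ (tendsto_norm_cobounded_atTop.comp tendsto_inv₀_nhdsNE_zero)
    refine tendsto_atTop_mono (fun w ↦ ?_) h0
    calc ‖w⁻¹‖ + -‖(x₀ : ℂ)‖ = ‖w⁻¹‖ - ‖-(x₀ : ℂ)‖ := by rw [norm_neg]; ring
      _ ≤ ‖w⁻¹ - -(x₀ : ℂ)‖ := norm_sub_norm_le _ _
      _ = ‖(x₀ : ℂ) + w⁻¹‖ := by ring_nf
  have h2 : Tendsto (fun w : ℂ ↦ g (x₀ + w⁻¹) - (x₀ + w⁻¹)) (𝓝[≠] 0) (𝓝 0) :=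
    h.tendsto_sub.comp h1
  have h3 : Tendsto (invertAt g x₀) (𝓝[≠] 0) (𝓝 0) := by
    refine h2.congr' ?_
    filter_upwards [self_mem_nhdsWithin] with w hw
    rw [invertAt_of_ne hw]; ring
  have h4 : Tendsto (invertAt g x₀) (pure 0) (𝓝 0) := by
    simpa using tendsto_pure_nhds (invertAt g x₀) 0
  exact (h3.sup h4).mono_left (nhdsNE_sup_pure (0 : ℂ)).ge

/-- **`f` is holomorphic on the whole disc `|w| < 1/r`** (removable singularity at `0`).
[folklore] -/
theorem differentiableOn_invertAt (h : IsHydrodynamicAt g x₀ r) :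
    DifferentiableOn ℂ (invertAt g x₀) (ball 0 r⁻¹) :=
  (Complex.differentiableOn_compl_singleton_and_continuousAt_iff
    (ball_mem_nhds 0 (inv_pos.2 h.pos))).1
    ⟨h.differentiableOn_invertAt_punctured, h.continuousAt_invertAt⟩

/-- `f` is real on the real diameter. [folklore] -/
theorem invertAt_ofReal_im (h : IsHydrodynamicAt g x₀ r) {t : ℝ} (ht : (t : ℂ) ∈ ball (0 : ℂ) r⁻¹) :
    (invertAt g x₀ t).im = 0 := by
  rcases eq_or_ne (t : ℂ) 0 with ht0 | ht0
  · rw [ht0, invertAt_zero, zero_im]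
  rw [invertAt_of_ne ht0]
  have hz := h.lt_norm_of_mem_ball ht ht0
  have hreal : conj ((x₀ : ℂ) + (t : ℂ)⁻¹) = (x₀ : ℂ) + (t : ℂ)⁻¹ := by
    simp [map_add, Complex.conj_ofReal]
  have hg : (g ((x₀ : ℂ) + (t : ℂ)⁻¹)).im = 0 := by
    have := h.map_conj _ hz
    rw [hreal] at this
    exact Complex.conj_eq_iff_im.1 this.symm
  have hinv : ((t : ℂ)⁻¹).im = 0 := by rw [← Complex.ofReal_inv]; exact Complex.ofReal_im _
  simp only [sub_im, hg, Complex.ofReal_im, hinv, sub_zero]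

/-- **Sign of `Im f`**: `Im w ≥ 0 ⇒ Im f(w) ≥ 0` (for `Im w > 0` the point `x₀ + 1/w` is in the
LOWER half-plane, where `Im (g - id) ≥ 0` by the symmetry and `Im g ≤ Im` above). [folklore] -/
theorem invertAt_im_nonneg (h : IsHydrodynamicAt g x₀ r) {w : ℂ} (hw : w ∈ ball (0 : ℂ) r⁻¹)
    (hwi : 0 ≤ w.im) : 0 ≤ (invertAt g x₀ w).im := by
  rcases hwi.lt_or_eq with hpos | hzero
  · have hw0 : w ≠ 0 := by rintro rfl; simp at hpos
    rw [invertAt_of_ne hw0]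
    set z : ℂ := (x₀ : ℂ) + w⁻¹ with hz
    have hzr : r < ‖z - x₀‖ := h.lt_norm_of_mem_ball hw hw0
    have hzim : z.im < 0 := by
      simp only [hz, add_im, Complex.ofReal_im, zero_add, Complex.inv_im]
      exact div_neg_of_neg_of_pos (neg_neg_of_pos hpos) (Complex.normSq_pos.2 hw0)
    -- the conjugate point is in the upper half-plane
    have hcr : r < ‖conj z - x₀‖ := by
      rw [← Complex.conj_ofReal x₀, ← map_sub, Complex.norm_conj]; exact hzr
    have hci : 0 < (conj z).im := by rw [Complex.conj_im]; linarith
    have h1 := h.im_le _ hcr hci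
    have h2 : conj (g (conj z)) = g z := by rw [← h.map_conj _ hcr, Complex.conj_conj]
    have h3 : (g z).im = -(g (conj z)).im := by rw [← h2, Complex.conj_im]
    have h4 : (g z - x₀ - w⁻¹).im = (g z).im - z.im := by rw [hz]; simp
    rw [h4, h3]
    rw [Complex.conj_im] at h1 hci
    linarith
  · have hw' : w = ((w.re : ℝ) : ℂ) := Complex.ext (by simp) (by simp [hzero.symm])
    rw [hw'] at hw ⊢
    exact (h.invertAt_ofReal_im hw).symm.le

/-- `Im w ≤ 0 ⇒ Im f(w) ≤ 0` (by the symmetry `f(w̄) = \overline{f(w)}`). [folklore] -/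
theorem invertAt_im_nonpos (h : IsHydrodynamicAt g x₀ r) {w : ℂ} (hw : w ∈ ball (0 : ℂ) r⁻¹)
    (hwi : w.im ≤ 0) : (invertAt g x₀ w).im ≤ 0 := by
  have hcw : conj w ∈ ball (0 : ℂ) r⁻¹ := by rwa [mem_ball_zero_iff, Complex.norm_conj, ← mem_ball_zero_iff]
  have h1 := h.invertAt_im_nonneg hcw (by rw [Complex.conj_im]; linarith)
  -- `f(conj w) = conj (f w)`
  have hsymm : invertAt g x₀ (conj w) = conj (invertAt g x₀ w) := by
    rcases eq_or_ne w 0 with rfl | hw0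
    · simp
    have hcw0 : conj w ≠ 0 := by rwa [map_ne_zero]
    rw [invertAt_of_ne hw0, invertAt_of_ne hcw0]
    have hz := h.lt_norm_of_mem_ball hw hw0
    have : (x₀ : ℂ) + (conj w)⁻¹ = conj ((x₀ : ℂ) + w⁻¹) := by simp [Complex.conj_ofReal]
    rw [this, h.map_conj _ hz]
    simp [Complex.conj_ofReal]
  rw [hsymm, Complex.conj_im] at h1
  linarith

/-- The derivative `f'(0)` is real. [folklore] -/
theorem deriv_invertAt_im (h : IsHydrodynamicAt g x₀ r) : (deriv (invertAt g x₀) 0).im = 0 := by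
  have hd : HasDerivAt (invertAt g x₀) (deriv (invertAt g x₀) 0) 0 :=
    (h.differentiableOn_invertAt.differentiableAt (ball_mem_nhds 0 (inv_pos.2 h.pos))).hasDerivAt
  -- difference quotients along the real axis are real
  have h1 : Tendsto (fun w ↦ w⁻¹ * invertAt g x₀ w) (𝓝[≠] 0) (𝓝 (deriv (invertAt g x₀) 0)) := by
    refine hd.tendsto_slope_zero.congr' ?_
    filter_upwards [self_mem_nhdsWithin] with w hw
    simp [smul_eq_mul]
  have h2 : Tendsto (fun t : ℝ ↦ (t : ℂ)) (𝓝[≠] 0) (𝓝[≠] (0 : ℂ)) :=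
    tendsto_nhdsWithin_iff.2 ⟨by simpa using (Complex.continuous_ofReal.tendsto 0).mono_left nhdsWithin_le_nhds,
      by
        filter_upwards [self_mem_nhdsWithin] with t ht
        simp only [mem_compl_iff, mem_singleton_iff] at ht ⊢
        exact_mod_cast ht⟩
  have h3 := ((Complex.continuous_im.tendsto _).comp (h1.comp h2))
  have hev : ∀ᶠ t : ℝ in 𝓝[≠] 0, (((t : ℂ))⁻¹ * invertAt g x₀ t).im = 0 := by
    have hball : ∀ᶠ t : ℝ in 𝓝 0, (t : ℂ) ∈ ball (0 : ℂ) r⁻¹ :=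
      Complex.continuous_ofReal.continuousAt.preimage_mem_nhds (by simpa using ball_mem_nhds (0 : ℂ) (inv_pos.2 h.pos))
    filter_upwards [mem_nhdsWithin_of_mem_nhds hball] with t ht
    rw [← Complex.ofReal_inv, Complex.im_ofReal_mul, h.invertAt_ofReal_im ht, mul_zero]
  haveI : (𝓝[≠] (0 : ℝ)).NeBot := NormedField.nhdsNE_neBot 0
  have h4 : Tendsto (fun t : ℝ ↦ (((t : ℂ))⁻¹ * invertAt g x₀ t).im) (𝓝[≠] 0) (𝓝 0) :=
    tendsto_const_nhds.congr' (hev.mono fun t ht ↦ ht.symm)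
  exact tendsto_nhds_unique h3 h4

/-- `f'(0) = hcapAt g x₀` as a complex number. [folklore] -/
theorem deriv_invertAt_eq (h : IsHydrodynamicAt g x₀ r) : deriv (invertAt g x₀) 0 = (hcapAt g x₀ : ℂ) :=
  Complex.ext (by simp [hcapAt]) (by simp [h.deriv_invertAt_im])

/-- **The capacity coefficient is nonnegative** (`Re p(0) ≥ 0` for Rogosinski's `p` of the
typically real `f`). [folklore] -/
theorem hcapAt_nonneg (h : IsHydrodynamicAt g x₀ r) : 0 ≤ hcapAt g x₀ := by
  -- rescale to the unit disc: `F(w) = f(w/r)`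
  set F : ℂ → ℂ := fun w ↦ invertAt g x₀ ((r : ℂ)⁻¹ * w) with hF
  have hr : (r : ℂ) ≠ 0 := by exact_mod_cast h.pos.ne'
  have hmem : ∀ w ∈ ball (0 : ℂ) 1, (r : ℂ)⁻¹ * w ∈ ball (0 : ℂ) r⁻¹ := fun w hw ↦ by
    rw [mem_ball_zero_iff] at hw ⊢
    rw [norm_mul, norm_inv, Complex.norm_real, Real.norm_of_nonneg h.pos.le]
    exact mul_lt_of_lt_one_right (inv_pos.2 h.pos) hw
  have hFt : IsTypicallyReal F :=
    { differentiableOn := h.differentiableOn_invertAt.comp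
        ((differentiableOn_const _).mul differentiableOn_id) hmem
      map_zero := by simp [hF]
      im_nonneg := fun w hw hwi ↦ h.invertAt_im_nonneg (hmem w hw) (by
        rw [← Complex.ofReal_inv, Complex.im_ofReal_mul]; exact mul_nonneg (inv_nonneg.2 h.pos.le) hwi)
      im_nonpos := fun w hw hwi ↦ h.invertAt_im_nonpos (hmem w hw) (by
        rw [← Complex.ofReal_inv, Complex.im_ofReal_mul]
        exact mul_nonpos_of_nonneg_of_nonpos (inv_nonneg.2 h.pos.le) hwi) }
  have h0 := hFt.re_rogosinski_nonneg (mem_ball_self one_pos)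
  rw [IsTypicallyReal.rogosinski_zero] at h0
  have hderiv : deriv F 0 = (r : ℂ)⁻¹ * deriv (invertAt g x₀) 0 := by
    simp only [hF]
    have hd : HasDerivAt (invertAt g x₀) (deriv (invertAt g x₀) 0) ((r : ℂ)⁻¹ * 0) := by
      rw [mul_zero]
      exact (h.differentiableOn_invertAt.differentiableAt (ball_mem_nhds 0 (inv_pos.2 h.pos))).hasDerivAt
    have h1 : HasDerivAt (fun w : ℂ ↦ (r : ℂ)⁻¹ * w) (r : ℂ)⁻¹ 0 := by
      simpa using (hasDerivAt_id (0 : ℂ)).const_mul (r : ℂ)⁻¹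
    have h2 : HasDerivAt (fun w ↦ invertAt g x₀ ((r : ℂ)⁻¹ * w))
        (deriv (invertAt g x₀) 0 * (r : ℂ)⁻¹) 0 := hd.comp 0 h1
    rw [h2.deriv]; ring
  rw [hderiv, h.deriv_invertAt_eq, ← Complex.ofReal_inv, ← Complex.ofReal_mul, Complex.ofReal_re] at h0
  exact (mul_nonneg_iff_of_pos_left (inv_pos.2 h.pos)).1 h0

/-- **The small-hull expansion** (Lawler (2005), Prop. 3.46, with `c = 6` and without
Brownian motion): if `a = hcapAt g x₀ > 0` then
`|g(z) - z - a/(z - x₀)| ≤ 6 a r/|z - x₀|²` for `|z - x₀| ≥ 2r`. [cite: Lawler2005, Prop. 3.46] -/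
theorem norm_sub_sub_div_le (h : IsHydrodynamicAt g x₀ r) (ha : 0 < hcapAt g x₀) {z : ℂ}
    (hz : 2 * r ≤ ‖z - x₀‖) :
    ‖g z - z - hcapAt g x₀ / (z - x₀)‖ ≤ 6 * hcapAt g x₀ * r / ‖z - x₀‖ ^ 2 := by
  have hz0 : z - x₀ ≠ 0 := by
    intro h0; rw [h0, norm_zero] at hz; linarith [h.pos]
  have hzx : z ≠ x₀ := sub_ne_zero.1 hz0
  set w : ℂ := (z - x₀)⁻¹ with hw
  have hw0 : w ≠ 0 := inv_ne_zero hz0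
  have hnw : ‖w‖ = ‖z - x₀‖⁻¹ := by rw [hw, norm_inv]
  have hwle : ‖w‖ ≤ r⁻¹ / 2 := by
    rw [hnw, inv_eq_one_div, inv_eq_one_div, div_div, one_div_le_one_div (by positivity : (0:ℝ) < ‖z - x₀‖) (by linarith [h.pos])]
    linarith
  have key := norm_sub_le_of_ball (f := invertAt g x₀) (inv_pos.2 h.pos) ha h.differentiableOn_invertAt
    (invertAt_zero g x₀) h.deriv_invertAt_eq (fun w hw hwi ↦ h.invertAt_im_nonneg hw hwi)
    (fun w hw hwi ↦ h.invertAt_im_nonpos hw hwi) hwle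
  rw [hw, invertAt_inv_sub hzx] at key
  have h1 : (hcapAt g x₀ : ℂ) * (z - ↑x₀)⁻¹ = hcapAt g x₀ / (z - x₀) := by rw [div_eq_mul_inv]
  rw [h1] at key
  refine key.trans (le_of_eq ?_)
  rw [norm_inv, inv_pow]
  field_simp

/-- `|g(z) - z| ≤ 4a/|z - x₀|` for `|z - x₀| ≥ 2r` (`a = hcapAt g x₀ > 0`). [cite: Lawler2005, Prop. 3.46] -/
theorem norm_sub_self_le (h : IsHydrodynamicAt g x₀ r) (ha : 0 < hcapAt g x₀) {z : ℂ}
    (hz : 2 * r ≤ ‖z - x₀‖) : ‖g z - z‖ ≤ 4 * hcapAt g x₀ / ‖z - x₀‖ := by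
  have hpos : 0 < ‖z - x₀‖ := by linarith [h.pos]
  have h1 := h.norm_sub_sub_div_le ha hz
  have h2 : ‖(hcapAt g x₀ : ℂ) / (z - x₀)‖ = hcapAt g x₀ / ‖z - x₀‖ := by
    rw [norm_div, Complex.norm_real, Real.norm_of_nonneg ha.le]
  have h3 : 6 * hcapAt g x₀ * r / ‖z - x₀‖ ^ 2 ≤ 3 * hcapAt g x₀ / ‖z - x₀‖ := by
    rw [div_le_div_iff₀ (by positivity) hpos]
    have h4 : 6 * hcapAt g x₀ * r ≤ 3 * hcapAt g x₀ * ‖z - x₀‖ := by nlinarith [ha.le, hz]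
    calc 6 * hcapAt g x₀ * r * ‖z - ↑x₀‖ ≤ 3 * hcapAt g x₀ * ‖z - x₀‖ * ‖z - x₀‖ :=
          mul_le_mul_of_nonneg_right h4 (norm_nonneg _)
      _ = 3 * hcapAt g x₀ * ‖z - ↑x₀‖ ^ 2 := by ring
  calc ‖g z - z‖ = ‖(g z - z - hcapAt g x₀ / (z - x₀)) + hcapAt g x₀ / (z - x₀)‖ := by ring_nf
    _ ≤ ‖g z - z - hcapAt g x₀ / (z - x₀)‖ + ‖(hcapAt g x₀ : ℂ) / (z - x₀)‖ := norm_add_le _ _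
    _ ≤ 3 * hcapAt g x₀ / ‖z - x₀‖ + hcapAt g x₀ / ‖z - x₀‖ := add_le_add (h1.trans h3) h2.le
    _ = 4 * hcapAt g x₀ / ‖z - x₀‖ := by ring

/-- **`(z - x₀)(g(z) - z) → a`** at `∞`: the capacity coefficient is Lawler's
`hcap = lim z (g(z) - z)` (Def. 3.37). [cite: Lawler2005, §3.4 Def. 3.37] -/
theorem tendsto_mul_sub_hcapAt (h : IsHydrodynamicAt g x₀ r) :
    Tendsto (fun z ↦ (z - x₀) * (g z - z)) (cocompact ℂ) (𝓝 (hcapAt g x₀ : ℂ)) := by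
  -- `f(w)/w → f'(0)` as `w → 0`, `w ≠ 0`
  have hd : HasDerivAt (invertAt g x₀) (hcapAt g x₀ : ℂ) 0 := by
    rw [← h.deriv_invertAt_eq]
    exact (h.differentiableOn_invertAt.differentiableAt (ball_mem_nhds 0 (inv_pos.2 h.pos))).hasDerivAt
  have h1 : Tendsto (fun w ↦ w⁻¹ * invertAt g x₀ w) (𝓝[≠] 0) (𝓝 (hcapAt g x₀ : ℂ)) := by
    have := hd.tendsto_slope_zero
    refine this.congr' ?_
    filter_upwards [self_mem_nhdsWithin] with w hw
    simp [invertAt_zero, smul_eq_mul]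
  -- `w = 1/(z - x₀) → 0` within `≠ 0` as `z → ∞`
  have hev : ∀ᶠ z : ℂ in cocompact ℂ, z ≠ x₀ := by
    filter_upwards [(isCompact_singleton (x := (x₀ : ℂ))).compl_mem_cocompact] with z hz
    simpa using hz
  have h2 : Tendsto (fun z : ℂ ↦ (z - x₀)⁻¹) (cocompact ℂ) (𝓝[≠] 0) := by
    refine tendsto_nhdsWithin_iff.2 ⟨?_, hev.mono fun z hz ↦ inv_ne_zero (sub_ne_zero.2 hz)⟩
    have hsub : Tendsto (fun z : ℂ ↦ z - x₀) (cocompact ℂ) (cobounded ℂ) := by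
      rw [← cobounded_eq_cocompact, ← tendsto_norm_atTop_iff_cobounded]
      have h0 : Tendsto (fun z : ℂ ↦ ‖z‖ + -‖(x₀ : ℂ)‖) (cobounded ℂ) atTop :=
        tendsto_atTop_add_const_right _ _ tendsto_norm_cobounded_atTop
      refine tendsto_atTop_mono (fun z ↦ ?_) h0
      have := norm_sub_norm_le z (x₀ : ℂ)
      linarith
    exact tendsto_inv₀_cobounded.comp hsub
  have h3 := h1.comp h2
  refine h3.congr' ?_
  filter_upwards [hev] with z hz
  simp only [Function.comp_apply, inv_inv, invertAt_inv_sub hz]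

end IsHydrodynamicAt

end Literature.Analysis.Complex

end
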